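import Literature.NumberTheory.Sieve.SmoothParitySingularLocal
import HarnessLib

/-!
# The cancelling majorant `classLocalHc`: reduction to modulus one, local structure, multiplicative majorant

Topic `Literature/NumberTheory/Sieve`, namespace `Literature.NumberTheory.Sieve.SmoothArcs`; a PROVED tool file of the
circle-method engine of `SmoothParityTernary` ([Harper2016, §2.2, §5], [MontgomeryVaughanActa1975, §5–6]).  Notation:
`Hc(m,r,k;h) = classLocalHc α m r k h = Σ_{g ∣ L} |C_g(h)| g^{−α} τ(L/g)/φ(L/g)` (`L = lcm(k,m)`, `SmoothArcClassesMajorant`),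
`c_q(h)` the Ramanujan sum, and the MODULUS-ONE majorant
`𝓗(k;h) = unitLocalHc α k h = Σ_{g ∣ k} |c_{k/g}(h)| g^{−α} τ(k/g)/φ(k/g)` (`= Hc(1,r,k;h)`, `classLocalHc_one_eq`).
This file prepares the uniform bound for the arithmetic sum `𝓗₃(R) = ΣΣ Hc₁Hc₂Hc₃` of `parity_major_arcs`
(`SmoothParityHcSum`):

* `classLocalHc_two_one_le`: `Hc(2,1,k;h) ≤ 2 𝓗(k;h)` for EVERY `k` (`k` odd: equality, `classLocalHc_of_coprime`;
  `k` even: `L = k` and the parity class only removes the fibres with even gcd, `classLocalHc_two_one_le_of_two_dvd`);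
* `unitLocalHc_mul_unit` (`𝓗(k;hu) = 𝓗(k;h)` for units `u`), `unitLocalHc_mul_of_coprime` (multiplicative in `k`, CRT);
* prime powers: the recurrence `𝓗(p^{j+1};h) = p^{−α}𝓗(p^j;h) + |c_{p^{j+1}}(h)| τ(p^{j+1})/φ(p^{j+1})`, Kluyver's values
  `|c_{p^{e+1}}(h)| = φ(p^{e+1}), p^e, 0` according as `p^{e+1} ∣ h`, `p^e ∥ h`, `p^e ∤ h`, whence
  `𝓗(p^j;h) ≤ (2j+1) p^j p^{−jα}` if `p^j ∣ h`, `𝓗(p^{v+1+i};h) ≤ (4v+5) p^v p^{−(v+1+i)α}` if `p^v ∥ h` (`α ≤ 1`), and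
  `unitLocalHc_prime_pow_le`: `𝓗(p^j;h) ≤ 5 (h,p^j) τ((h,p^j)) p^{−jα}`;
* the multiplicative majorant `unitHcMajorant α n k = (n,k) τ((n,k)) · k^{−α} ∏_{p ∣ k} 5` and
  `unitLocalHc_le_majorant`: `𝓗(k;h) ≤ unitHcMajorant α |h| k` for all `k ≥ 1`, `α ≤ 1`.

## References

* A. J. Harper, Compositio Math. 152 (2016), §2.2, §5 [Harper2016].
* H. L. Montgomery, R. C. Vaughan, Acta Arith. 27 (1975), §5–6 [MontgomeryVaughanActa1975].
* H. L. Montgomery, R. C. Vaughan, *Multiplicative Number Theory I* (2007), Thm 4.1 [MontgomeryVaughan2007].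
-/

noncomputable section

open Finset Real Complex

namespace Literature.NumberTheory.Sieve

namespace SmoothArcs

/-! ### The modulus-one majorant and the reduction of the parity classes to it -/

/-- The modulus-one cancelling majorant `𝓗_α(k; h) = Σ_{g ∣ k} |c_{k/g}(h)| g^{−α} τ(k/g)/φ(k/g)`.
[cite: Harper2016, §2.2] -/
def unitLocalHc (α : ℝ) (k : ℕ) (h : ℤ) : ℝ :=
  ∑ g ∈ k.divisors, ‖ramanujanSum (k / g) h‖ *
    (((g : ℕ) : ℝ) ^ (-α) * ((k / g).divisors.card : ℝ) / ((k / g).totient : ℝ))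

/-- `𝓗(k; h) ≥ 0`. [folklore] -/
theorem unitLocalHc_nonneg (α : ℝ) (k : ℕ) (h : ℤ) : 0 ≤ unitLocalHc α k h :=
  Finset.sum_nonneg fun g _ => mul_nonneg (norm_nonneg _)
    (div_nonneg (mul_nonneg (Real.rpow_nonneg (Nat.cast_nonneg g) _) (Nat.cast_nonneg _)) (Nat.cast_nonneg _))

/-- `𝓗(1; h) = 1`. [folklore] -/
theorem unitLocalHc_one (α : ℝ) (h : ℤ) : unitLocalHc α 1 h = 1 := by
  simp [unitLocalHc]

/-- `Hc(1, r, k; h) = 𝓗(k; h)`: for modulus `1` the class is invisible (`classLocalHc_of_coprime`). [folklore] -/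
theorem classLocalHc_one_eq (α : ℝ) (r k : ℕ) (h : ℤ) : classLocalHc α 1 r k h = unitLocalHc α k h := by
  rcases eq_or_ne k 0 with rfl | hk
  · simp [classLocalHc, unitLocalHc]
  rw [classLocalHc_of_coprime α hk one_ne_zero (Nat.coprime_one_right k) (Nat.coprime_one_right r) h,
    Nat.divisors_one, Finset.card_singleton, Nat.totient_one, Nat.cast_one, div_one, one_mul]
  rfl

/-- For EVEN `k` the parity class only removes fibres: `L = lcm(k,2) = k`, `C_g(h; 2,1,k) = C_g(h; 1,0,k)` for odd `g`
(a `t` with `(t,k) = g` odd is odd) and `= 0` for even `g` (no odd `t` has even gcd), so `Hc(2,1,k;h) ≤ Hc(1,0,k;h)`.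
[folklore] -/
theorem classLocalHc_two_one_le_of_two_dvd (α : ℝ) {k : ℕ} (h2 : 2 ∣ k) (h : ℤ) :
    classLocalHc α 2 1 k h ≤ classLocalHc α 1 0 k h := by
  unfold classLocalHc
  rw [Nat.lcm_eq_left h2, Nat.lcm_one_right]
  refine Finset.sum_le_sum fun g _ => mul_le_mul_of_nonneg_right ?_
    (div_nonneg (mul_nonneg (Real.rpow_nonneg (Nat.cast_nonneg g) _) (Nat.cast_nonneg _)) (Nat.cast_nonneg _))
  unfold classGcdSum
  rw [Nat.lcm_eq_left h2, Nat.lcm_one_right]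
  by_cases hg2 : 2 ∣ g
  · have hempty : ∀ t ∈ Finset.range k, ¬ (t ≡ 1 [MOD 2] ∧ Nat.gcd t k = g) := by
      rintro t - ⟨ht1, htg⟩
      have h2t : 2 ∣ t := by
        have hgt := Nat.gcd_dvd_left t k
        rw [htg] at hgt
        exact hg2.trans hgt
      unfold Nat.ModEq at ht1
      omega
    rw [Finset.filter_false_of_mem hempty, Finset.sum_empty, norm_zero]
    exact norm_nonneg _
  · refine le_of_eq (congrArg _ (Finset.sum_congr (Finset.filter_congr fun t _ => ?_) fun _ _ => rfl))
    constructor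
    · rintro ⟨-, htg⟩
      exact ⟨Nat.modEq_one, htg⟩
    · rintro ⟨-, htg⟩
      refine ⟨?_, htg⟩
      by_contra hne
      apply hg2
      rw [← htg]
      refine Nat.dvd_gcd ?_ h2
      unfold Nat.ModEq at hne
      omega

/-- **Reduction of the parity classes to modulus one**: `Hc(2,1,k;h) ≤ 2 𝓗(k;h)` for every `k` and `h`
(`k` odd: `Hc(2,1,k;h) = τ(2)/φ(2) · 𝓗(k;h) = 2𝓗(k;h)` by `classLocalHc_of_coprime`; `k` even:
`classLocalHc_two_one_le_of_two_dvd`). [cite: Harper2016, §2.2] -/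
theorem classLocalHc_two_one_le (α : ℝ) (k : ℕ) (h : ℤ) : classLocalHc α 2 1 k h ≤ 2 * unitLocalHc α k h := by
  rcases eq_or_ne k 0 with rfl | hk
  · simp [classLocalHc, unitLocalHc]
  rcases Nat.even_or_odd k with he | ho
  · calc classLocalHc α 2 1 k h ≤ classLocalHc α 1 0 k h := classLocalHc_two_one_le_of_two_dvd α he.two_dvd h
      _ = unitLocalHc α k h := classLocalHc_one_eq α 0 k h
      _ ≤ 2 * unitLocalHc α k h := by linarith [unitLocalHc_nonneg α k h]
  · have hk2 : k.Coprime 2 := (Nat.prime_two.coprime_iff_not_dvd.mpr ho.not_two_dvd_nat).symm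
    rw [classLocalHc_of_coprime α hk two_ne_zero hk2 (Nat.coprime_one_left 2) h, ← classLocalHc_one_eq α 0,
      classLocalHc_of_coprime α hk one_ne_zero (Nat.coprime_one_right k) (Nat.coprime_one_right 0) h,
      Nat.prime_two.divisors, Nat.totient_two, Nat.divisors_one, Nat.totient_one,
      Finset.card_pair (by norm_num : (1 : ℕ) ≠ 2), Finset.card_singleton]
    apply le_of_eq
    push_cast
    ring

/-! ### Invariances: units, CRT multiplicativity -/

/-- `𝓗(k; hu) = 𝓗(k; h)` for `(u, k) = 1` (`c_q(hu) = c_q(h)` for `q ∣ k`). [folklore] -/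
theorem unitLocalHc_mul_unit (α : ℝ) {k : ℕ} {u : ℤ} (hu : k.Coprime u.natAbs) (h : ℤ) :
    unitLocalHc α k (h * u) = unitLocalHc α k h := by
  unfold unitLocalHc
  refine Finset.sum_congr rfl fun g hg => ?_
  rw [ramanujanSum_mul_of_coprime_right
    (hu.coprime_dvd_left (Nat.div_dvd_of_dvd (Nat.dvd_of_mem_divisors hg)))]

/-- `𝓗(·; h)` is multiplicative: `𝓗(k₁k₂; h) = 𝓗(k₁; h) 𝓗(k₂; h)` for coprime `k₁, k₂` (CRT, `classLocalHc_mul_of_coprime`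
with `m₁ = m₂ = 1`; the unit twists are invisible). [folklore] -/
theorem unitLocalHc_mul_of_coprime (α : ℝ) {k₁ k₂ : ℕ} (hk : k₁.Coprime k₂) (h : ℤ) :
    unitLocalHc α (k₁ * k₂) h = unitLocalHc α k₁ h * unitLocalHc α k₂ h := by
  rcases eq_or_ne k₁ 0 with rfl | hk₁
  · simp [unitLocalHc]
  rcases eq_or_ne k₂ 0 with rfl | hk₂
  · simp [unitLocalHc]
  obtain ⟨u₁, hu₁⟩ := exists_nat_mul_modEq_one hk hk₁
  obtain ⟨u₂, hu₂⟩ := exists_nat_mul_modEq_one hk.symm hk₂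
  have hu₁' : (u₁ : ℤ) * k₂ ≡ 1 [ZMOD k₁] := by
    have := Int.natCast_modEq_iff.mpr hu₁; push_cast at this; exact this
  have hu₂' : (u₂ : ℤ) * k₁ ≡ 1 [ZMOD k₂] := by
    have := Int.natCast_modEq_iff.mpr hu₂; push_cast at this; exact this
  have hc1 : (k₁ * 1).Coprime (k₂ * 1) := by simpa using hk
  have key := classLocalHc_mul_of_coprime α hk₁ hk₂ one_ne_zero one_ne_zero hc1 0 hu₁' hu₂' (h := h)
  rw [mul_one, classLocalHc_one_eq, classLocalHc_one_eq, classLocalHc_one_eq,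
    unitLocalHc_mul_unit α (by simpa using (Nat.coprime_of_mul_modEq_one k₂ hu₁).symm) h,
    unitLocalHc_mul_unit α (by simpa using (Nat.coprime_of_mul_modEq_one k₁ hu₂).symm) h] at key
  exact key

/-! ### Prime powers -/

/-- `τ(p^k) = k + 1`. [folklore] -/
theorem divisors_card_prime_pow {p : ℕ} (hp : p.Prime) (k : ℕ) : (p ^ k).divisors.card = k + 1 := by
  rw [Nat.divisors_prime_pow hp k, Finset.card_map, Finset.card_range]

/-- **Recurrence in the exponent**:
`𝓗(p^{j+1}; h) = p^{−α} 𝓗(p^j; h) + |c_{p^{j+1}}(h)| τ(p^{j+1})/φ(p^{j+1})` (shift `g = p g'`; the divisor `g = 1` is the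
extra term). [folklore] -/
theorem unitLocalHc_prime_pow_succ (α : ℝ) {p : ℕ} (hp : p.Prime) (j : ℕ) (h : ℤ) :
    unitLocalHc α (p ^ (j + 1)) h = (p : ℝ) ^ (-α) * unitLocalHc α (p ^ j) h +
      ‖ramanujanSum (p ^ (j + 1)) h‖ * ((p ^ (j + 1)).divisors.card : ℝ) / ((p ^ (j + 1)).totient : ℝ) := by
  rw [divisors_card_prime_pow hp (j + 1)]
  unfold unitLocalHc
  rw [Nat.divisors_prime_pow hp (j + 1), Nat.divisors_prime_pow hp j, Finset.sum_map, Finset.sum_map]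
  simp only [Function.Embedding.coeFn_mk]
  rw [Finset.sum_range_succ', Finset.mul_sum]
  congr 1
  · refine Finset.sum_congr rfl fun i hi => ?_
    have hi' : i < j + 1 := Finset.mem_range.mp hi
    rw [Nat.pow_div (by omega) hp.pos, Nat.pow_div (by omega) hp.pos, show j + 1 - (i + 1) = j - i by omega]
    have e1 : (((p ^ (i + 1) : ℕ)) : ℝ) ^ (-α) = (p : ℝ) ^ (-α) * (((p ^ i : ℕ)) : ℝ) ^ (-α) := by
      push_cast
      rw [pow_succ, Real.mul_rpow (by positivity) (by positivity), mul_comm]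
    rw [e1]
    ring
  · rw [pow_zero, Nat.div_one, Nat.cast_one, Real.one_rpow, one_mul, divisors_card_prime_pow hp (j + 1)]
    ring

/-- Kluyver at prime powers, first case: `|c_{p^{e+1}}(h)| = φ(p^{e+1})` if `p^{e+1} ∣ h`.
[cite: MontgomeryVaughan2007, Thm 4.1 eq. (4.7)] -/
theorem norm_ramanujanSum_prime_pow_succ_of_dvd {p : ℕ} (hp : p.Prime) {e : ℕ} {h : ℤ}
    (hd : p ^ (e + 1) ∣ h.natAbs) : ‖ramanujanSum (p ^ (e + 1)) h‖ = ((p ^ (e + 1)).totient : ℝ) := by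
  have hd' : p ^ e ∣ h.natAbs := (pow_dvd_pow p (Nat.le_succ e)).trans hd
  rw [ramanujanSum_eq_ramanujanDivisorSum, Complex.norm_intCast, ramanujanDivisorSum_prime_pow_succ _ hp,
    if_pos hd, if_pos hd', Nat.totient_prime_pow_succ hp]
  have hc : ((p - 1 : ℕ) : ℝ) = (p : ℝ) - 1 := by rw [Nat.cast_sub hp.one_le, Nat.cast_one]
  have hp1 : (1 : ℝ) ≤ p := by exact_mod_cast hp.one_le
  have hpe : (0 : ℝ) ≤ (p : ℝ) ^ e := by positivity
  push_cast
  rw [hc, show (p : ℝ) ^ (e + 1) - (p : ℝ) ^ e = (p : ℝ) ^ e * ((p : ℝ) - 1) by ring,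
    abs_of_nonneg (mul_nonneg hpe (by linarith))]

/-- Second case: `|c_{p^{e+1}}(h)| = p^e` if `p^e ∥ h`. [cite: MontgomeryVaughan2007, Thm 4.1 eq. (4.7)] -/
theorem norm_ramanujanSum_prime_pow_succ_of_not_dvd {p : ℕ} (hp : p.Prime) {e : ℕ} {h : ℤ}
    (hd : p ^ e ∣ h.natAbs) (hd' : ¬ p ^ (e + 1) ∣ h.natAbs) :
    ‖ramanujanSum (p ^ (e + 1)) h‖ = ((p ^ e : ℕ) : ℝ) := by
  rw [ramanujanSum_eq_ramanujanDivisorSum, Complex.norm_intCast, ramanujanDivisorSum_prime_pow_succ _ hp,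
    if_neg hd', if_pos hd, zero_sub, Int.cast_neg, abs_neg, Int.cast_natCast, Nat.abs_cast]

/-- Third case: `c_{p^{e+1}}(h) = 0` if `p^e ∤ h`. [cite: MontgomeryVaughan2007, Thm 4.1 eq. (4.7)] -/
theorem ramanujanSum_prime_pow_succ_eq_zero {p : ℕ} (hp : p.Prime) {e : ℕ} {h : ℤ} (hd : ¬ p ^ e ∣ h.natAbs) :
    ramanujanSum (p ^ (e + 1)) h = 0 := by
  have hd' : ¬ p ^ (e + 1) ∣ h.natAbs := fun h' => hd ((pow_dvd_pow p (Nat.le_succ e)).trans h')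
  rw [ramanujanSum_eq_ramanujanDivisorSum, ramanujanDivisorSum_prime_pow_succ _ hp, if_neg hd', if_neg hd, sub_zero,
    Int.cast_zero]

/-- `1 ≤ P · P^{−α}` for `P ≥ 1`, `α ≤ 1`. [folklore] -/
theorem one_le_mul_rpow_neg {P α : ℝ} (hP : 1 ≤ P) (hα : α ≤ 1) : 1 ≤ P * P ^ (-α) := by
  have hP0 : 0 < P := by linarith
  rw [show P * P ^ (-α) = P ^ (1 - α) by rw [sub_eq_add_neg, Real.rpow_add hP0, Real.rpow_one]]
  exact Real.one_le_rpow hP (by linarith)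

/-- `(p^{j+1})^{−α} = p^{−α} (p^j)^{−α}`. [folklore] -/
theorem rpow_neg_pow_succ (p j : ℕ) (α : ℝ) :
    ((p ^ (j + 1) : ℕ) : ℝ) ^ (-α) = (p : ℝ) ^ (-α) * ((p ^ j : ℕ) : ℝ) ^ (-α) := by
  push_cast
  rw [pow_succ, Real.mul_rpow (by positivity) (by positivity), mul_comm]

/-- The arithmetic of the inductive step when `p^{j+1} ∣ h`. [folklore] -/
theorem hc_step_of_dvd {p A U j : ℝ} (hp : 2 ≤ p) (hA : 0 ≤ A) (hpA : 1 ≤ p * A) (hj : 0 ≤ j)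
    (hU : U ≤ (2 * j + 1) * A) : U + (j + 2) ≤ (2 * j + 3) * (p * A) := by
  nlinarith [mul_nonneg (by linarith : (0 : ℝ) ≤ j + 2) (by linarith : (0 : ℝ) ≤ p * A - 1),
    mul_nonneg (mul_nonneg (by linarith : (0 : ℝ) ≤ j + 1) (by linarith : (0 : ℝ) ≤ p - 2)) hA]

/-- The arithmetic of the step `v → v + 1` when `p^v ∥ h`. [folklore] -/
theorem hc_step_of_not_dvd {p A U v : ℝ} (hp : 2 ≤ p) (hA : 0 ≤ A) (hpA : 1 ≤ p * A) (hv : 0 ≤ v)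
    (hU : U ≤ (2 * v + 1) * A) : U + (v + 2) / (p - 1) ≤ (4 * v + 5) * A := by
  have h1 : (v + 2) / (p - 1) ≤ 2 * (v + 2) * A := by
    rw [div_le_iff₀ (by linarith)]
    nlinarith [mul_nonneg (by linarith : (0 : ℝ) ≤ v + 2)
      (add_nonneg (by linarith : (0 : ℝ) ≤ p * A - 1) (mul_nonneg hA (by linarith : (0 : ℝ) ≤ p - 2)))]
  linarith

/-- **`𝓗(p^j; h) ≤ (2j+1) p^j (p^j)^{−α}` if `p^j ∣ h`** (`α ≤ 1`; induction on `j` with the recurrence, each step adding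
`|c_{p^{j+1}}(h)| τ/φ = τ(p^{j+1}) = j + 2`). [folklore] -/
theorem unitLocalHc_prime_pow_le_of_dvd {α : ℝ} (hα1 : α ≤ 1) {p : ℕ} (hp : p.Prime) {h : ℤ} {j : ℕ}
    (hdvd : p ^ j ∣ h.natAbs) :
    unitLocalHc α (p ^ j) h ≤ (2 * j + 1) * ((p ^ j : ℕ) : ℝ) * ((p ^ j : ℕ) : ℝ) ^ (-α) := by
  induction j with
  | zero => simp [unitLocalHc_one]
  | succ j ih =>
    have hj : p ^ j ∣ h.natAbs := (pow_dvd_pow p (Nat.le_succ j)).trans hdvd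
    have hp0 : (0 : ℝ) < p := by exact_mod_cast hp.pos
    have hp2 : (2 : ℝ) ≤ p := by exact_mod_cast hp.two_le
    have hφ : ((p ^ (j + 1)).totient : ℝ) ≠ 0 := by exact_mod_cast (Nat.totient_pos.mpr (pow_pos hp.pos _)).ne'
    rw [unitLocalHc_prime_pow_succ α hp, norm_ramanujanSum_prime_pow_succ_of_dvd hp hdvd,
      divisors_card_prime_pow hp (j + 1), mul_div_cancel_left₀ _ hφ]
    set A : ℝ := ((p ^ j : ℕ) : ℝ) * ((p ^ (j + 1) : ℕ) : ℝ) ^ (-α) with hA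
    have hA0 : 0 ≤ A := by positivity
    have hPA : ((p ^ (j + 1) : ℕ) : ℝ) * ((p ^ (j + 1) : ℕ) : ℝ) ^ (-α) = (p : ℝ) * A := by
      rw [hA]; push_cast; ring
    have hpA : 1 ≤ (p : ℝ) * A :=
      hPA ▸ one_le_mul_rpow_neg (by exact_mod_cast Nat.one_le_pow _ _ hp.pos) hα1
    have hU : (p : ℝ) ^ (-α) * unitLocalHc α (p ^ j) h ≤ (2 * j + 1) * A := by
      calc (p : ℝ) ^ (-α) * unitLocalHc α (p ^ j) h
          ≤ (p : ℝ) ^ (-α) * ((2 * j + 1) * ((p ^ j : ℕ) : ℝ) * ((p ^ j : ℕ) : ℝ) ^ (-α)) :=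
            mul_le_mul_of_nonneg_left (ih hj) (Real.rpow_nonneg hp0.le _)
        _ = (2 * j + 1) * A := by rw [hA, rpow_neg_pow_succ]; ring
    calc (p : ℝ) ^ (-α) * unitLocalHc α (p ^ j) h + ((j + 1 + 1 : ℕ) : ℝ)
        = (p : ℝ) ^ (-α) * unitLocalHc α (p ^ j) h + ((j : ℝ) + 2) := by push_cast; ring
      _ ≤ (2 * (j : ℝ) + 3) * ((p : ℝ) * A) := hc_step_of_dvd hp2 hA0 hpA (Nat.cast_nonneg j) hU
      _ = (2 * ((j + 1 : ℕ) : ℝ) + 1) * (((p ^ (j + 1) : ℕ) : ℝ) * ((p ^ (j + 1) : ℕ) : ℝ) ^ (-α)) := by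
          rw [hPA]; push_cast; ring
      _ = _ := by ring

/-- **`𝓗(p^{v+1+i}; h) ≤ (4v+5) p^v (p^{v+1+i})^{−α}` if `p^v ∥ h`** (`α ≤ 1`): the step `v → v+1` adds
`p^v τ(p^{v+1})/φ(p^{v+1}) = (v+2)/(p−1)`, the later steps add nothing (`c = 0`). [folklore] -/
theorem unitLocalHc_prime_pow_le_of_not_dvd {α : ℝ} (hα1 : α ≤ 1) {p : ℕ} (hp : p.Prime) {h : ℤ} {v : ℕ}
    (hv : p ^ v ∣ h.natAbs) (hv' : ¬ p ^ (v + 1) ∣ h.natAbs) (i : ℕ) :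
    unitLocalHc α (p ^ (v + 1 + i)) h ≤ (4 * v + 5) * ((p ^ v : ℕ) : ℝ) * ((p ^ (v + 1 + i) : ℕ) : ℝ) ^ (-α) := by
  have hp0 : (0 : ℝ) < p := by exact_mod_cast hp.pos
  have hp2 : (2 : ℝ) ≤ p := by exact_mod_cast hp.two_le
  induction i with
  | zero =>
    rw [add_zero, unitLocalHc_prime_pow_succ α hp, norm_ramanujanSum_prime_pow_succ_of_not_dvd hp hv hv',
      divisors_card_prime_pow hp (v + 1), Nat.totient_prime_pow_succ hp, Nat.cast_mul]
    have hc : ((p - 1 : ℕ) : ℝ) = (p : ℝ) - 1 := by rw [Nat.cast_sub hp.one_le, Nat.cast_one]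
    have hpv : ((p ^ v : ℕ) : ℝ) ≠ 0 := by exact_mod_cast (pow_pos hp.pos v).ne'
    rw [hc, mul_div_mul_left _ _ hpv]
    set A : ℝ := ((p ^ v : ℕ) : ℝ) * ((p ^ (v + 1) : ℕ) : ℝ) ^ (-α) with hA
    have hA0 : 0 ≤ A := by positivity
    have hPA : ((p ^ (v + 1) : ℕ) : ℝ) * ((p ^ (v + 1) : ℕ) : ℝ) ^ (-α) = (p : ℝ) * A := by
      rw [hA]; push_cast; ring
    have hpA : 1 ≤ (p : ℝ) * A :=
      hPA ▸ one_le_mul_rpow_neg (by exact_mod_cast Nat.one_le_pow _ _ hp.pos) hα1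
    have hU : (p : ℝ) ^ (-α) * unitLocalHc α (p ^ v) h ≤ (2 * v + 1) * A := by
      calc (p : ℝ) ^ (-α) * unitLocalHc α (p ^ v) h
          ≤ (p : ℝ) ^ (-α) * ((2 * v + 1) * ((p ^ v : ℕ) : ℝ) * ((p ^ v : ℕ) : ℝ) ^ (-α)) :=
            mul_le_mul_of_nonneg_left (unitLocalHc_prime_pow_le_of_dvd hα1 hp hv) (Real.rpow_nonneg hp0.le _)
        _ = (2 * v + 1) * A := by rw [hA, rpow_neg_pow_succ]; ring
    calc (p : ℝ) ^ (-α) * unitLocalHc α (p ^ v) h + ((v + 1 + 1 : ℕ) : ℝ) / ((p : ℝ) - 1)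
        = (p : ℝ) ^ (-α) * unitLocalHc α (p ^ v) h + ((v : ℝ) + 2) / ((p : ℝ) - 1) := by push_cast; ring_nf
      _ ≤ (4 * (v : ℝ) + 5) * A := hc_step_of_not_dvd hp2 hA0 hpA (Nat.cast_nonneg v) hU
      _ = _ := by rw [hA]; ring
  | succ i ih =>
    have e : v + 1 + (i + 1) = (v + 1 + i) + 1 := by ring
    have hn1 : ¬ p ^ (v + 1 + i) ∣ h.natAbs := fun hd => hv' ((pow_dvd_pow p (by omega)).trans hd)
    rw [e, unitLocalHc_prime_pow_succ α hp, ramanujanSum_prime_pow_succ_eq_zero hp hn1, norm_zero, zero_mul,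
      zero_div, add_zero, rpow_neg_pow_succ p (v + 1 + i)]
    calc (p : ℝ) ^ (-α) * unitLocalHc α (p ^ (v + 1 + i)) h
        ≤ (p : ℝ) ^ (-α) * ((4 * v + 5) * ((p ^ v : ℕ) : ℝ) * ((p ^ (v + 1 + i) : ℕ) : ℝ) ^ (-α)) :=
          mul_le_mul_of_nonneg_left ih (Real.rpow_nonneg hp0.le _)
      _ = _ := by ring

/-- **The prime-power bound** `𝓗(p^j; h) ≤ 5 · (h, p^j) τ((h, p^j)) · (p^j)^{−α}` (`α ≤ 1`; `(2j+1) ≤ 5(j+1)` in the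
first case, `p^v ≤ (h,p^j)`, `v + 1 ≤ τ((h,p^j))` in the second). [folklore] -/
theorem unitLocalHc_prime_pow_le {α : ℝ} (hα1 : α ≤ 1) {p : ℕ} (hp : p.Prime) (j : ℕ) (h : ℤ) :
    unitLocalHc α (p ^ j) h ≤ 5 * (((Nat.gcd h.natAbs (p ^ j) : ℕ) : ℝ) *
      ((Nat.gcd h.natAbs (p ^ j)).divisors.card : ℝ)) * ((p ^ j : ℕ) : ℝ) ^ (-α) := by
  have hX : 0 ≤ ((p ^ j : ℕ) : ℝ) ^ (-α) := Real.rpow_nonneg (Nat.cast_nonneg _) _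
  by_cases hdvd : p ^ j ∣ h.natAbs
  · rw [Nat.gcd_eq_right hdvd, divisors_card_prime_pow hp]
    refine (unitLocalHc_prime_pow_le_of_dvd hα1 hp hdvd).trans (mul_le_mul_of_nonneg_right ?_ hX)
    have hP : (0 : ℝ) ≤ ((p ^ j : ℕ) : ℝ) := Nat.cast_nonneg _
    push_cast at hP ⊢
    nlinarith [mul_nonneg hP (by positivity : (0 : ℝ) ≤ 3 * (j : ℝ) + 4)]
  · obtain ⟨v, i, rfl, hv, hv'⟩ := exists_eq_add_of_not_pow_dvd hp hdvd
    refine (unitLocalHc_prime_pow_le_of_not_dvd hα1 hp hv hv' i).trans (mul_le_mul_of_nonneg_right ?_ hX)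
    set g : ℕ := Nat.gcd h.natAbs (p ^ (v + 1 + i)) with hg
    have hg0 : 0 < g := Nat.gcd_pos_of_pos_right _ (pow_pos hp.pos _)
    have hpg : p ^ v ∣ g := Nat.dvd_gcd hv (pow_dvd_pow p (by omega))
    have h1 : ((p ^ v : ℕ) : ℝ) ≤ (g : ℝ) := by exact_mod_cast Nat.le_of_dvd hg0 hpg
    have h2 : ((v + 1 : ℕ) : ℝ) ≤ (g.divisors.card : ℝ) := by
      rw [← divisors_card_prime_pow hp v]
      exact_mod_cast Finset.card_le_card (Nat.divisors_subset_of_dvd hg0.ne' hpg)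
    have hv0 : (0 : ℝ) ≤ v := Nat.cast_nonneg v
    have hP : (0 : ℝ) ≤ ((p ^ v : ℕ) : ℝ) := Nat.cast_nonneg _
    push_cast at h1 h2 ⊢
    calc (4 * (v : ℝ) + 5) * (p : ℝ) ^ v ≤ (5 * ((v : ℝ) + 1)) * (p : ℝ) ^ v := by
          push_cast at hP; nlinarith
      _ ≤ (5 * (g.divisors.card : ℝ)) * (g : ℝ) := by
          push_cast at hP
          exact mul_le_mul (by linarith) h1 hP (by positivity)
      _ = 5 * ((g : ℝ) * (g.divisors.card : ℝ)) := by ring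

/-! ### The multiplicative majorant -/

/-- The multiplicative majorant `(n, k) τ((n, k)) · k^{−α} ∏_{p ∣ k} 5` of `𝓗(k; ±n)`. [folklore] -/
def unitHcMajorant (α : ℝ) (n k : ℕ) : ℝ :=
  ((Nat.gcd n k : ℕ) : ℝ) * ((Nat.gcd n k).divisors.card : ℝ) * ((k : ℝ) ^ (-α) * ∏ _p ∈ k.primeFactors, (5 : ℝ))

/-- The majorant is `≥ 0`. [folklore] -/
theorem unitHcMajorant_nonneg (α : ℝ) (n k : ℕ) : 0 ≤ unitHcMajorant α n k :=
  mul_nonneg (mul_nonneg (Nat.cast_nonneg _) (Nat.cast_nonneg _))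
    (mul_nonneg (Real.rpow_nonneg (Nat.cast_nonneg _) _) (Finset.prod_nonneg fun _ _ => by norm_num))

/-- The majorant is multiplicative on coprime arguments. [folklore] -/
theorem unitHcMajorant_mul_of_coprime (α : ℝ) (n : ℕ) {a b : ℕ} (hab : a.Coprime b) :
    unitHcMajorant α n (a * b) = unitHcMajorant α n a * unitHcMajorant α n b := by
  unfold unitHcMajorant
  have hg : (Nat.gcd n a).Coprime (Nat.gcd n b) :=
    Nat.Coprime.coprime_dvd_left (Nat.gcd_dvd_right n a) (Nat.Coprime.coprime_dvd_right (Nat.gcd_dvd_right n b) hab)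
  rw [Nat.Coprime.gcd_mul n hab, Nat.Coprime.card_divisors_mul hg, Nat.Coprime.primeFactors_mul hab,
    Finset.prod_union hab.disjoint_primeFactors]
  push_cast
  rw [Real.mul_rpow (Nat.cast_nonneg a) (Nat.cast_nonneg b)]
  ring

/-- **The pointwise majorant** `𝓗(k; h) ≤ unitHcMajorant α |h| k` for all `k ≥ 1`, `α ≤ 1` (multiplicativity of both
sides and the prime-power bound). [cite: Harper2016, §2.2] -/
theorem unitLocalHc_le_majorant {α : ℝ} (hα1 : α ≤ 1) (h : ℤ) {k : ℕ} (hk : k ≠ 0) :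
    unitLocalHc α k h ≤ unitHcMajorant α h.natAbs k := by
  induction k using Nat.recOnPosPrimePosCoprime with
  | zero => exact absurd rfl hk
  | one => simp [unitLocalHc_one, unitHcMajorant]
  | prime_pow p n hp hn =>
    refine (unitLocalHc_prime_pow_le hα1 hp n h).trans (le_of_eq ?_)
    rw [unitHcMajorant, Nat.primeFactors_prime_pow hn.ne' hp, Finset.prod_singleton]
    ring
  | coprime a b ha hb hab iha ihb =>
    rw [unitLocalHc_mul_of_coprime α hab, unitHcMajorant_mul_of_coprime α _ hab]
    exact mul_le_mul (iha (by omega)) (ihb (by omega)) (unitLocalHc_nonneg _ _ _) (unitHcMajorant_nonneg _ _ _)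

end SmoothArcs

end Literature.NumberTheory.Sieve

end
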